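import Mathlib
import HarnessLib
import Literature.Analysis.FluidPDE.PoincareHomotopyOperator
import Literature.Analysis.FluidPDE.VectorCalculusProofs
import Literature.Analysis.FluidPDE.DivFreeVectorPotential
import Literature.Analysis.FluidPDE.NewtonKernel
import Literature.Analysis.FluidPDE.LeiZhang2011Proofs
import Literature.Analysis.FunctionSpaces.SmoothParametricIntegral

/-!
# Route `QuarterLogPincer`, crux `TypeIQuantSubcubicExp` (stmt-NavierStokesRegularity-24077), line `truncation_edge` — towards stub T1
# `stub_farFieldTruncation`: DIVERGENCE-FREE TRUNCATION OF AN ENVELOPED SOLENOIDAL FIELD WITH SUP CONTROL (the datum)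

Companion of `…TruncationEdgeOseenStability` (pub-ns-dss typer g35; helper `--supports stmt-NavierStokesRegularity-24077`).
T1 (`StubFarFieldTruncation`, `Theorems/QuarterLogPincerTruncationEdgeDefs.lean`) wants a finite-energy truncation of an enveloped
Type-I ancient mild field `v` (`HasTypeIDecay A v`: `‖v(s,x)‖ ≤ A/(‖x‖ + √(−s))`) issued at `s = −1`.  The line card proposes the
datum `χ_R v(−1) + b_R` with a Bogovskiĭ corrector `b_R`; the tree holds Bogovskiĭ's operator only qualitatively (sup bounds for it
would need the unproved `L^q` estimates).  This file supplies the datum by an EXPLICIT, scaling-covariant construction instead — the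
cut-off of the tree's POINCARÉ (cone) VECTOR POTENTIAL `conePotential v = ∫₀¹ t v(t·) × · dt` (`PoincareHomotopyOperator.lean`,
Fonda 2018 Thm. 3.31):

  `u₀ := curl (ζ_R · conePotential v) = ζ_R v + ∇ζ_R × conePotential v`,  `ζ_R = θ(·/R)`, `θ = radialCutoff 1 2`.

* `norm_conePotential_le_of_envelope` — THE ENVELOPE MAKES THE POTENTIAL BOUNDED: `‖v(x)‖ ≤ A/(‖x‖+1)` ⇒ `‖conePotential v (x)‖ ≤ A`
  for all `x` (`t‖x‖·A/(t‖x‖+1) ≤ A`).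
* `contDiff_conePotential` — smooth `v` ⇒ smooth potential (`Literature.Analysis.FunctionSpaces.contDiff_parametric_intervalIntegral`).
* `curl_conePotential_eq` — the POINTWISE Poincaré lemma `curl (conePotential v) = v` for smooth divergence-free `v` (from the tree's
  distributional identity `integral_inner_conePotential_curl`, integration by parts `integral_inner_curl_eq_integral_inner_curl`, and the
  fundamental lemma `ae_eq_zero_of_integral_contDiff_smul_eq_zero`).
* `exists_divFree_truncation` — for smooth divergence-free `v` with the envelope and every `R > 0`: a smooth, divergence-free,
  compactly supported (`= 0` off `B̄(2R)`) field `u₀`, `= v` on `B(R)`, with `‖u₀(x) − v(x)‖ ≤ K·A/R` for ALL `x` (`K` universal).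

READING for T1: applied to the slice `v(−1,·)` (smooth and divergence free by `IsTypeIAncientMild`, enveloped by `HasTypeIDecay A v`),
`u₀` is an admissible Tao-frame datum (smooth with compact support, so in every `H^k`) within `η = K·A/R` of `v(−1)` in sup norm — the
input of the Oseen-gauge stability estimate `exists_sub_typeIAncientMild_le`, which then gives clause (iii) of T1 with a POLYNOMIAL
radius `R ≍ (A/δ)(2/ε)^{κ(M)}`.  NOT addressed: existence of the Tao-frame solution from `u₀` on `[0, 1−ε]` and clause (ii) (see the
typer's sizing note, evidence #58 on 24077).  HONEST FRAME: vector calculus about HYPOTHETICAL objects; T1, 24077 and NS regularity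
are OPEN and untouched.
-/

noncomputable section

set_option linter.dupNamespace false

namespace Summit.NavierStokesRegularity.NavierStokesRegularity.Theorems.QuarterLogPincerTruncationEdge

open MeasureTheory Set Function Filter Real Metric InnerProductSpace
open scoped ENNReal NNReal Topology RealInnerProductSpace ContDiff
open Literature.Analysis Literature.Analysis.FluidPDE

/-! ## The cone potential of a smooth field: sup bound, smoothness, and the pointwise Poincaré lemma -/

/-- **Sup bound for the cone potential of an enveloped field**: if `‖f(x)‖ ≤ A/(‖x‖ + 1)` then
`‖conePotential f (x)‖ ≤ A` for every `x` (`‖t f(tx) × x‖ ≤ t‖x‖·A/(t‖x‖+1) ≤ A` on `(0,1]`). [folklore] -/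
theorem norm_conePotential_le_of_envelope {f : EuclideanSpace ℝ (Fin 3) → EuclideanSpace ℝ (Fin 3)} {A : ℝ}
    (hA : 0 ≤ A) (hf : ∀ x, ‖f x‖ ≤ A / (‖x‖ + 1)) (x : EuclideanSpace ℝ (Fin 3)) :
    ‖conePotential f x‖ ≤ A := by
  rw [conePotential]
  have h : ∀ t ∈ Set.uIoc (0:ℝ) 1, ‖coneIntegrand f t x‖ ≤ A := by
    intro t ht
    rw [uIoc_of_le zero_le_one] at ht
    have ht0 : 0 < t := ht.1
    rw [coneIntegrand_apply, norm_smul, Real.norm_of_nonneg ht0.le]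
    have h1 : ‖cross (f (t • x)) x‖ ≤ ‖f (t • x)‖ * ‖x‖ := norm_cross_le_norm_mul_norm _ _
    have h2 : ‖f (t • x)‖ ≤ A / (‖t • x‖ + 1) := hf _
    rw [norm_smul, Real.norm_of_nonneg ht0.le] at h2
    have hden : 0 < t * ‖x‖ + 1 := by positivity
    calc t * ‖cross (f (t • x)) x‖ ≤ t * (A / (t * ‖x‖ + 1) * ‖x‖) := by
          refine mul_le_mul_of_nonneg_left (h1.trans ?_) ht0.le
          exact mul_le_mul_of_nonneg_right h2 (norm_nonneg _)
      _ = A * (t * ‖x‖ / (t * ‖x‖ + 1)) := by ring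
      _ ≤ A * 1 := by
          refine mul_le_mul_of_nonneg_left ?_ hA
          rw [div_le_one hden]; linarith
      _ = A := mul_one A
  have := intervalIntegral.norm_integral_le_of_norm_le_const h
  simpa using this

/-- The cone potential of a smooth field is smooth (differentiation under the integral sign,
`Literature.Analysis.FunctionSpaces.contDiff_parametric_intervalIntegral`). [folklore] -/
theorem contDiff_conePotential {g : EuclideanSpace ℝ (Fin 3) → EuclideanSpace ℝ (Fin 3)}
    (hg : ContDiff ℝ ∞ g) : ContDiff ℝ ∞ (conePotential g) := by
  have hH : ContDiff ℝ ∞ fun q : ℝ × EuclideanSpace ℝ (Fin 3) => q.1 • cross (g (q.1 • q.2)) q.2 := by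
    have h1 : ContDiff ℝ ∞ fun q : ℝ × EuclideanSpace ℝ (Fin 3) => g (q.1 • q.2) :=
      hg.comp (contDiff_fst.smul contDiff_snd)
    have h2 : ContDiff ℝ ∞ fun q : ℝ × EuclideanSpace ℝ (Fin 3) => cross (g (q.1 • q.2)) q.2 :=
      (crossCLM.contDiff.comp h1).clm_apply contDiff_snd
    exact contDiff_fst.smul h2
  have e : conePotential g = fun p => ∫ σ in (0:ℝ)..1, σ • cross (g (σ • p)) p := by
    funext p; rfl
  rw [e]
  exact Literature.Analysis.FunctionSpaces.contDiff_parametric_intervalIntegral hH 0 1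

/-- **The pointwise Poincaré lemma for `2`-forms**: for a smooth divergence-free field `g` on `ℝ³`,
`curl (conePotential g) = g` everywhere (from the tree's distributional identity `integral_inner_conePotential_curl`,
integration by parts for the curl, and the fundamental lemma of the calculus of variations). [cite: Fonda2018, Thm. 3.31] -/
theorem curl_conePotential_eq {g : EuclideanSpace ℝ (Fin 3) → EuclideanSpace ℝ (Fin 3)}
    (hg : ContDiff ℝ ∞ g) (hdiv : ∀ y, VectorCalculus.divergence g y = 0) (x : EuclideanSpace ℝ (Fin 3)) :
    curl (conePotential g) x = g x := by
  have hΦ : ContDiff ℝ ∞ (conePotential g) := contDiff_conePotential hg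
  have hΦ1 : ContDiff ℝ 1 (conePotential g) := hΦ.of_le (by exact_mod_cast le_top)
  have hg1 : ContDiff ℝ 1 g := hg.of_le (by exact_mod_cast le_top)
  set f : EuclideanSpace ℝ (Fin 3) → EuclideanSpace ℝ (Fin 3) := fun y => curl (conePotential g) y - g y with hf
  have hfc : Continuous f := (continuous_curl hΦ1).sub hg.continuous
  -- `∫ ⟪f, Ψ⟫ = 0` for every `C¹_c` test field
  have hweak : ∀ Ψ : EuclideanSpace ℝ (Fin 3) → EuclideanSpace ℝ (Fin 3), ContDiff ℝ 1 Ψ → HasCompactSupport Ψ →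
      ∫ y, ⟪f y, Ψ y⟫ = 0 := by
    intro Ψ hΨ hΨc
    have h1 := integral_inner_curl_eq_integral_inner_curl hΦ1 hΨ hΨc
    have h2 := integral_inner_conePotential_curl hg1 hdiv hΨ hΨc
    have i1 : Integrable (fun y => ⟪curl (conePotential g) y, Ψ y⟫) (volume : Measure (EuclideanSpace ℝ (Fin 3))) :=
      integrable_inner_of_hasCompactSupport_right (continuous_curl hΦ1) hΨ.continuous hΨc
    have i2 : Integrable (fun y => ⟪g y, Ψ y⟫) (volume : Measure (EuclideanSpace ℝ (Fin 3))) :=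
      integrable_inner_of_hasCompactSupport_right hg.continuous hΨ.continuous hΨc
    have e : (fun y => ⟪f y, Ψ y⟫) = fun y => ⟪curl (conePotential g) y, Ψ y⟫ - ⟪g y, Ψ y⟫ := by
      funext y; simp only [hf, inner_sub_left]
    rw [e, integral_sub i1 i2, h1, h2, sub_self]
  -- the fundamental lemma, vector form
  have hae : ∀ᵐ y ∂(volume : Measure (EuclideanSpace ℝ (Fin 3))), f y = 0 := by
    refine ae_eq_zero_of_integral_contDiff_smul_eq_zero hfc.locallyIntegrable fun φ hφ hφc => ?_
    refine ext_inner_left ℝ fun w => ?_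
    have hφfc : HasCompactSupport fun y => φ y • f y :=
      HasCompactSupport.intro hφc fun y hy => by rw [image_eq_zero_of_notMem_tsupport hy, zero_smul]
    have hint : Integrable (fun y => φ y • f y) (volume : Measure (EuclideanSpace ℝ (Fin 3))) :=
      (hφ.continuous.smul hfc).integrable_of_hasCompactSupport hφfc
    rw [← integral_inner hint w, inner_zero_right]
    have hΨ : ContDiff ℝ 1 fun y => φ y • w := (hφ.of_le (by exact_mod_cast le_top)).smul contDiff_const
    have hΨc : HasCompactSupport fun y => φ y • w :=
      HasCompactSupport.intro hφc fun y hy => by rw [image_eq_zero_of_notMem_tsupport hy, zero_smul]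
    have := hweak _ hΨ hΨc
    have e : (fun y => ⟪w, φ y • f y⟫) = fun y => ⟪f y, φ y • w⟫ := by
      funext y; rw [inner_smul_right, inner_smul_right, real_inner_comm]
    rw [e]; exact this
  have hzero : f = 0 := (Continuous.ae_eq_iff_eq volume hfc continuous_const).1 hae
  have := congrFun hzero x
  simp only [hf, Pi.zero_apply, sub_eq_zero] at this
  exact this

/-! ## The divergence-free truncation -/

/-- **DIVERGENCE-FREE TRUNCATION OF AN ENVELOPED SOLENOIDAL FIELD WITH SUP CONTROL.**  There is a universal `K > 0` such
that: for every smooth divergence-free `v : ℝ³ → ℝ³` with the envelope `‖v(x)‖ ≤ A/(‖x‖ + 1)` (`A ≥ 0`) and every radius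
`R > 0`, the field `u₀ := curl (ζ_R · conePotential v)` — `ζ_R = θ(·/R)` the tree's radial cut-off `radialCutoff 1 2` (`= 1` on
`B(R)`, `= 0` off `B(2R)`), `conePotential v = ∫₀¹ t v(t·) × · dt` the Poincaré vector potential (`curl (conePotential v) = v`) — is
smooth, divergence free, compactly supported (it vanishes off `B̄(2R)`), equals `v` on the open ball `B(R)`, and
`‖u₀(x) − v(x)‖ ≤ K·A/R` for ALL `x` (`u₀ − v = (ζ_R − 1)v + ∇ζ_R × conePotential v`, with `|v| ≤ A/R` off `B(R)`,
`|∇ζ_R| ≤ K₁/R`, `|conePotential v| ≤ A`).  READING for T1 of line `truncation_edge` (crux 24077): the DATUM of the truncation —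
applied to `v(−1, ·)` of an enveloped Type-I ancient mild field (`IsTypeIAncientMild`, `HasTypeIDecay A v`), it is a smooth,
divergence-free, compactly supported (hence `H^k` for every `k`) initial datum within `K·A/R` of `v(−1)` in sup norm, which is the
`η ≲ A/R` fed to the Oseen-gauge stability estimate `exists_sub_typeIAncientMild_le` (`…TruncationEdgeOseenStability`); an explicit,
scaling-covariant replacement for the Bogovskiĭ corrector of the line card. [folklore; Fonda 2018 Thm. 3.31 for the potential] -/
theorem exists_divFree_truncation :
    ∃ K : ℝ, 0 < K ∧ ∀ {v : EuclideanSpace ℝ (Fin 3) → EuclideanSpace ℝ (Fin 3)} {A R : ℝ},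
      ContDiff ℝ ∞ v → (∀ y, VectorCalculus.divergence v y = 0) → 0 ≤ A →
      (∀ x, ‖v x‖ ≤ A / (‖x‖ + 1)) → 0 < R →
      ∃ u₀ : EuclideanSpace ℝ (Fin 3) → EuclideanSpace ℝ (Fin 3),
        ContDiff ℝ ∞ u₀ ∧ (∀ y, VectorCalculus.divergence u₀ y = 0) ∧ HasCompactSupport u₀ ∧
        (∀ x, 2 * R < ‖x‖ → u₀ x = 0) ∧ (∀ x, ‖x‖ < R → u₀ x = v x) ∧
        ∀ x, ‖u₀ x - v x‖ ≤ K * A / R := by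
  -- the unit cut-off and its gradient bound
  set θ : EuclideanSpace ℝ (Fin 3) → ℝ := radialCutoff 1 2 with hθ
  have hθs : ContDiff ℝ ∞ θ := radialCutoff_contDiff 1 2
  obtain ⟨K₁, hK₁, hDθ⟩ : ∃ K₁ : ℝ, 0 ≤ K₁ ∧ ∀ z, ‖fderiv ℝ θ z‖ ≤ K₁ := by
    have hd : ContDiff ℝ 1 θ := radialCutoff_contDiff 1 2
    have hc : Continuous (fderiv ℝ θ) := hd.continuous_fderiv one_ne_zero
    have hs : HasCompactSupport (fderiv ℝ θ) :=
      (hasCompactSupport_radialCutoff (E := EuclideanSpace ℝ (Fin 3)) zero_le_one one_lt_two).fderiv (𝕜 := ℝ)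
    obtain ⟨K, hK⟩ := hc.bounded_above_of_compact_support hs
    exact ⟨max K 0, le_max_right _ _, fun z => (hK z).trans (le_max_left _ _)⟩
  refine ⟨K₁ + 1, by positivity, ?_⟩
  intro v A R hv hdiv hA henv hR
  set ζ : EuclideanSpace ℝ (Fin 3) → ℝ := fun x => θ (R⁻¹ • x) with hζ
  have hζs : ContDiff ℝ ∞ ζ := hθs.comp (contDiff_const_smul R⁻¹)
  set Ψ : EuclideanSpace ℝ (Fin 3) → EuclideanSpace ℝ (Fin 3) := conePotential v with hΨ
  have hΨs : ContDiff ℝ ∞ Ψ := contDiff_conePotential hv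
  have hΨA : ∀ x, ‖Ψ x‖ ≤ A := norm_conePotential_le_of_envelope hA henv
  set W : EuclideanSpace ℝ (Fin 3) → EuclideanSpace ℝ (Fin 3) := fun x => ζ x • Ψ x with hW
  have hWs : ContDiff ℝ ∞ W := hζs.smul hΨs
  -- support of the cut potential
  have hζ0 : ∀ x, 2 * R ≤ ‖x‖ → ζ x = 0 := by
    intro x hx
    simp only [hζ, hθ]
    refine radialCutoff_eq_zero zero_le_one one_lt_two ?_
    rw [norm_smul, Real.norm_of_nonneg (inv_nonneg.2 hR.le), le_inv_mul_iff₀ hR]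
    linarith
  have hζ1 : ∀ x, ‖x‖ ≤ R → ζ x = 1 := by
    intro x hx
    simp only [hζ, hθ]
    refine radialCutoff_eq_one zero_le_one one_lt_two ?_
    rw [norm_smul, Real.norm_of_nonneg (inv_nonneg.2 hR.le), inv_mul_le_iff₀ hR]
    linarith
  have hWsupp : tsupport W ⊆ closedBall (0 : EuclideanSpace ℝ (Fin 3)) (2 * R) := by
    refine closure_minimal (fun x hx => ?_) isClosed_closedBall
    rw [mem_closedBall_zero_iff]
    by_contra h
    push Not at h
    exact hx (by simp only [hW, hζ0 x h.le, zero_smul])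
  have hWc : HasCompactSupport W :=
    (isCompact_closedBall (0 : EuclideanSpace ℝ (Fin 3)) (2 * R)).of_isClosed_subset isClosed_closure hWsupp
  -- the gradient of the scaled cut-off
  have hDζ : ∀ x, ‖fderiv ℝ ζ x‖ ≤ K₁ / R := by
    intro x
    have h1 : HasFDerivAt ζ ((fderiv ℝ θ (R⁻¹ • x)).comp (R⁻¹ • ContinuousLinearMap.id ℝ (EuclideanSpace ℝ (Fin 3)))) x :=
      ((hθs.differentiable (by simp)) (R⁻¹ • x)).hasFDerivAt.comp x ((hasFDerivAt_id x).const_smul R⁻¹)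
    rw [h1.fderiv]
    refine (ContinuousLinearMap.opNorm_comp_le _ _).trans ?_
    have h2 : ‖R⁻¹ • ContinuousLinearMap.id ℝ (EuclideanSpace ℝ (Fin 3))‖ ≤ R⁻¹ := by
      refine (ContinuousLinearMap.opNorm_smul_le _ _).trans ?_
      rw [Real.norm_of_nonneg (inv_nonneg.2 hR.le)]
      exact mul_le_of_le_one_right (inv_nonneg.2 hR.le) ContinuousLinearMap.norm_id_le
    calc ‖fderiv ℝ θ (R⁻¹ • x)‖ * ‖R⁻¹ • ContinuousLinearMap.id ℝ (EuclideanSpace ℝ (Fin 3))‖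
        ≤ K₁ * R⁻¹ := mul_le_mul (hDθ _) h2 (norm_nonneg _) hK₁
      _ = K₁ / R := by rw [div_eq_mul_inv]
  -- the formula `curl W = ζ v + ∇ζ × Ψ`
  have hformula : ∀ x, curl W x =
      ζ x • v x + cross ((InnerProductSpace.toDual ℝ (EuclideanSpace ℝ (Fin 3))).symm (fderiv ℝ ζ x)) (Ψ x) := by
    intro x
    have hζd : DifferentiableAt ℝ ζ x := (hζs.differentiable (by simp)) x
    have hΨd : DifferentiableAt ℝ Ψ x := (hΨs.differentiable (by simp)) x
    rw [show W = fun y => ζ y • Ψ y from rfl, curl_smul hζd hΨd, curlCLM_smulRight, hΨ,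
      curl_conePotential_eq hv hdiv x]
  refine ⟨curl W, ?_, ?_, hasCompactSupport_curl hWc, ?_, ?_, ?_⟩
  · exact contDiff_infty.2 fun n => contDiff_curl (hWs.of_le (by exact_mod_cast le_top))
  · intro y
    exact divergence_curl_eq_zero_holds W (contDiff_infty.1 hWs 2) y
  · intro x hx
    refine curl_eq_zero_of_notMem_tsupport fun h => ?_
    have := mem_closedBall_zero_iff.1 (hWsupp h)
    linarith
  · intro x hx
    have hev : ζ =ᶠ[𝓝 x] fun _ => (1:ℝ) := by
      have hball : ball (0 : EuclideanSpace ℝ (Fin 3)) R ∈ 𝓝 x := isOpen_ball.mem_nhds (mem_ball_zero_iff.2 hx)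
      filter_upwards [hball] with y hy
      exact hζ1 y (mem_ball_zero_iff.1 hy).le
    have hD0 : fderiv ℝ ζ x = 0 := by rw [hev.fderiv_eq]; exact fderiv_const_apply _
    rw [hformula x, hζ1 x hx.le, one_smul, hD0, map_zero]
    simp [cross]
  · intro x
    rw [hformula x]
    have e : ζ x • v x + cross ((InnerProductSpace.toDual ℝ (EuclideanSpace ℝ (Fin 3))).symm (fderiv ℝ ζ x)) (Ψ x) - v x
        = (ζ x - 1) • v x + cross ((InnerProductSpace.toDual ℝ (EuclideanSpace ℝ (Fin 3))).symm (fderiv ℝ ζ x)) (Ψ x) := by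
      rw [sub_smul, one_smul]; abel
    rw [e]
    refine (norm_add_le _ _).trans ?_
    -- the two terms
    have h1 : ‖(ζ x - 1) • v x‖ ≤ A / R := by
      by_cases hxR : ‖x‖ ≤ R
      · rw [hζ1 x hxR, sub_self, zero_smul, norm_zero]; positivity
      · push Not at hxR
        rw [norm_smul]
        have hz : ‖ζ x - 1‖ ≤ 1 := by
          rw [Real.norm_eq_abs, abs_sub_comm, abs_of_nonneg (by linarith [radialCutoff_le_one 1 2 (R⁻¹ • x)])]
          linarith [radialCutoff_nonneg 1 2 (R⁻¹ • x)]
        have hvx : ‖v x‖ ≤ A / R := (henv x).trans (div_le_div_of_nonneg_left hA hR (by linarith))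
        calc ‖ζ x - 1‖ * ‖v x‖ ≤ 1 * (A / R) := mul_le_mul hz hvx (norm_nonneg _) zero_le_one
          _ = A / R := one_mul _
    have h2 : ‖cross ((InnerProductSpace.toDual ℝ (EuclideanSpace ℝ (Fin 3))).symm (fderiv ℝ ζ x)) (Ψ x)‖ ≤ K₁ * A / R := by
      refine (norm_cross_le_norm_mul_norm _ _).trans ?_
      rw [LinearIsometryEquiv.norm_map]
      calc ‖fderiv ℝ ζ x‖ * ‖Ψ x‖ ≤ (K₁ / R) * A := mul_le_mul (hDζ x) (hΨA x) (norm_nonneg _) (by positivity)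
        _ = K₁ * A / R := by ring
    calc ‖(ζ x - 1) • v x‖ + ‖cross ((InnerProductSpace.toDual ℝ (EuclideanSpace ℝ (Fin 3))).symm (fderiv ℝ ζ x)) (Ψ x)‖
        ≤ A / R + K₁ * A / R := add_le_add h1 h2
      _ = (K₁ + 1) * A / R := by ring

end Summit.NavierStokesRegularity.NavierStokesRegularity.Theorems.QuarterLogPincerTruncationEdge

end
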